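import Summits.QuantumFields.YangMills.Theorems.BalabanUVNodesN15TwoSpacingGluingCurvedCoverDefectRows
import HarnessLib

/-!
# THE COVER's PARTITION SHIFTED ONE FINE STEP AGAINST ONE COARSE STEP THROUGH KING's PAIRING — the two-grid fits of `h_k(x + e)` and of the one-step differences `h_k(x + e) − h_k(x)`
# (n15-c∕167–169's `hf0`, `hf0b` at the cover; dag-n15-c g19, n15-c∕177b; N15 = NE2, s1 road (c))

Cell `pub-ymgap`, seat `pub-ymgap-dag-n15-c` (R134 (a); HUMAN RULING D-0062), generation 19.  `bears_on: R4∕N15 · K3⁸ SpineGivenEndpointR13SepCoPHV (stmt-QuantumFields-27366)`.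
Filed `--kind proof --supports stmt-QuantumFields-27366 --as helper` — COUNT-NEUTRAL.  Theorems only; 0 `def`, 0 `sorry`.  Imports BY NAME FILE 122 `…CurvedCoverDefectRows` (through it FILE 67
`abs_fgrad_coverH_le` ∕ `abs_bgrad_coverH_le`).  Nothing in the tree is modified.

WHAT.  `abs_coverH_step_le` ∕ `abs_coverH_step_symm_le` (`|h(x ± e_μ) − h(x)| ≤ (π∕w)∕n`), ★ `abs_coverH_step_two_grid_le` ∕ `abs_coverH_step_symm_two_grid_le` (`|(h′(x′ ± e′) − h′(x′)) −
(h(πx′ ± e) − h(πx′))| ≤ (π∕w)∕(L^rL^k) + (π∕w)∕L^k` — crude: each step separately).  Every right side is `O((L^k)⁻¹w⁻¹)`: small in the scale `k`.  (The shifted fit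
`|h′(x′ + e′_ν) − h(πx′ + e_ν)|` is dag-n15-c g12's `abs_coverH_shift_fine_sub_le` in `…NeumannKnitEntryOne` — not restated.)

HONEST FRAMING ∕ LIMITS.  Finite-difference bookkeeping of the cover's partition on dag-n15-a's model carriers; nothing of [B5]∕[B6]∕[B9] asserted ((2.36) p.229 «|∂h| ≤ O(1)M⁻¹»: shape;
Thm 3.14 pp.426–427: difference template).  NE2 for non-abelian `G(U)` NOT proved; N15 of record untouched (№253); no count; one finite 𝕋⁴ — NOT infinite volume, NOT OS, NOT a mass gap, NOT Clay.
-/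

noncomputable section

namespace Summit.QuantumFields.YangMills.BalabanUVNodes.N15.Gluing

open Real
open Literature.MathematicalPhysics.QuantumFieldTheory.Balaban1983to89
open Literature.MathematicalPhysics.QuantumFieldTheory.Balaban1983to89.B5Prop11Plancherel (Tor fine unitVec)
open Summit.QuantumFields.YangMills.BalabanUVNodes.N15.BackgroundLayer (fgrad bgrad fgrad_apply bgrad_apply)
open Summit.QuantumFields.YangMills.BalabanUVNodes.N15.VectorPiece (bshiftEquiv kingPrV)

variable {d : ℕ}

section Steps

variable {M : Fin (d + 1) → ℕ} [∀ μ, NeZero (M μ)] {n w q : ℕ} [NeZero n]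

/-- `|h_k(x + e_μ) − h_k(x)| ≤ (π∕w)∕n` (FILE 67 `abs_fgrad_coverH_le` divided by the weight). [cite: Balaban1984PropagatorsII, (2.36) p.229 (shape)] -/
theorem abs_coverH_step_le (hM : ∀ ν, M ν = 2 * q * w) (hw : 0 < w) (k : Fin (d + 1) → ZMod (2 * q)) (μ : Fin (d + 1)) (x : Tor (fine n M) × Fin (d + 1)) :
    |hcube (2 * q) (coverXi M n w) k (bshiftEquiv M n μ x) - hcube (2 * q) (coverXi M n w) k x| ≤ π / w / n := by
  have hn : (0 : ℝ) < n := Nat.cast_pos.mpr (Nat.pos_of_ne_zero (NeZero.ne n))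
  have h := abs_fgrad_coverH_le hM hw k μ x
  rw [fgrad_apply, abs_mul, abs_of_pos hn] at h
  rw [le_div_iff₀ hn, mul_comm]; exact h

/-- `|h_k(x) − h_k(x − e_μ)| ≤ (π∕w)∕n` (FILE 67 `abs_bgrad_coverH_le`). [cite: Balaban1984PropagatorsII, (2.36) p.229 (shape)] -/
theorem abs_coverH_step_symm_le (hM : ∀ ν, M ν = 2 * q * w) (hw : 0 < w) (k : Fin (d + 1) → ZMod (2 * q)) (μ : Fin (d + 1)) (x : Tor (fine n M) × Fin (d + 1)) :
    |hcube (2 * q) (coverXi M n w) k x - hcube (2 * q) (coverXi M n w) k ((bshiftEquiv M n μ).symm x)| ≤ π / w / n := by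
  have hn : (0 : ℝ) < n := Nat.cast_pos.mpr (Nat.pos_of_ne_zero (NeZero.ne n))
  have h := abs_bgrad_coverH_le hM hw k μ x
  rw [bgrad_apply, abs_mul, abs_of_pos hn] at h
  rw [le_div_iff₀ hn, mul_comm]; exact h

end Steps

section TwoGrid

variable {M : Fin (d + 1) → ℕ} [∀ μ, NeZero (M μ)] {L w q : ℕ} [NeZero L] (kk r : ℕ)

/-- ★ the two-grid fit of the FORWARD one-step difference (167's `hf0`), crude: `≤ (π∕w)∕(L^rL^k) + (π∕w)∕L^k`. [cite: Balaban1985BackgroundPropagators, Thm 3.14 pp.426–427 (shape)] -/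
theorem abs_coverH_step_two_grid_le (hM : ∀ ν, M ν = 2 * q * w) (hw : 0 < w) (k : Fin (d + 1) → ZMod (2 * q)) (μ : Fin (d + 1)) (x' : Tor (fine (L ^ r * L ^ kk) M) × Fin (d + 1)) :
    |(hcube (2 * q) (coverXi M (L ^ r * L ^ kk) w) k (bshiftEquiv M (L ^ r * L ^ kk) μ x') - hcube (2 * q) (coverXi M (L ^ r * L ^ kk) w) k x') -
        (hcube (2 * q) (coverXi M (L ^ kk) w) k (bshiftEquiv M (L ^ kk) μ (kingPrV L kk r M x')) - hcube (2 * q) (coverXi M (L ^ kk) w) k (kingPrV L kk r M x'))|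
      ≤ π / w / ((L ^ r * L ^ kk : ℕ) : ℝ) + π / w / ((L ^ kk : ℕ) : ℝ) :=
  (abs_sub _ _).trans (add_le_add (abs_coverH_step_le hM hw k μ x') (abs_coverH_step_le hM hw k μ _))

/-- ★ the two-grid fit of the BACKWARD one-step difference (167's `hf0b`). [cite: Balaban1985BackgroundPropagators, Thm 3.14 pp.426–427 (shape)] -/
theorem abs_coverH_step_symm_two_grid_le (hM : ∀ ν, M ν = 2 * q * w) (hw : 0 < w) (k : Fin (d + 1) → ZMod (2 * q)) (μ : Fin (d + 1)) (x' : Tor (fine (L ^ r * L ^ kk) M) × Fin (d + 1)) :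
    |(hcube (2 * q) (coverXi M (L ^ r * L ^ kk) w) k x' - hcube (2 * q) (coverXi M (L ^ r * L ^ kk) w) k ((bshiftEquiv M (L ^ r * L ^ kk) μ).symm x')) -
        (hcube (2 * q) (coverXi M (L ^ kk) w) k (kingPrV L kk r M x') - hcube (2 * q) (coverXi M (L ^ kk) w) k ((bshiftEquiv M (L ^ kk) μ).symm (kingPrV L kk r M x')))|
      ≤ π / w / ((L ^ r * L ^ kk : ℕ) : ℝ) + π / w / ((L ^ kk : ℕ) : ℝ) :=
  (abs_sub _ _).trans (add_le_add (abs_coverH_step_symm_le hM hw k μ x') (abs_coverH_step_symm_le hM hw k μ _))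

end TwoGrid

end Summit.QuantumFields.YangMills.BalabanUVNodes.N15.Gluing

end
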